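import Summits.QuantumFields.BalabanUV.T4Continuum.Support.InsertionChannelFamilyComplex
import Summits.QuantumFields.BalabanUV.T4Continuum.Support.OutputRateComplexSliceEnd
import Summits.QuantumFields.BalabanUV.T4Continuum.Support.OutputRateDrivingSlices

/-!
# InsertionChannelFamilyComplexEntrywise — the channel road carried to Road D, part 8: the COMPLEX CHANNEL ROAD's ENDs IN THE W1 ENTRY
# CURRENCY OF RECORD (`B13OpDatumJunctions.WeightedEntrywiseRate` over the recursion chart; the owner's adapter g36-c §4
# `OutputRateComplexSliceEntrywise.hop_of_weightedEntrywiseRate_floor` BY NAME), from the REAL WINDOW + per-entry slice letters (g36-c §3),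
# and from the real window + species-in-chart letters (L1) + coordinate slices (L2′)(L3) (owner g38-a §4, road-agnostic after RULING R58) —
# the channel-road SOCKET of the instance row E-avg
# (cell `pub-balaban`, T⁴ fan-out; row NE5, node U3; `HOME/t4/formal/NE5/LEAVES.md` row O1-c follower; parts 1–7 = p228265 ∕ p228521 ∕ p229012 ∕
# p229246 ∕ p231181 ∕ p231529 ∕ p231889; owner g36-c = p230570, g36-a = p229951, g38-a = p238560; INTENT `HOME/CLAIMS.log` l.22251)

Unit `b2b-balaban-t4-ne5-formalise-leaf-06` (NE5 formalisation swarm, leaf prover 06, gen 19).  Summits-side NEW WORK under the LEAN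
PLACEMENT RULE (cell bookkeeping over ABSTRACT carriers, charts and entry sets; nothing of the manuscripts under audit is asserted; 0 cite
tags; 0 `def`; no `Prop`-valued fact minted).  HONEST FRAMING: rung (B)+1 of the FINITE-VOLUME T⁴ continuum programme — NOT infinite
volume, NOT a mass gap, NOT the Clay problem, NOT a proof of NE5 (`T4OutputRate.NE5`, NOT PRINTED; cell GAPS G-t4-U3-1) nor of NE2 ∕ NE3 ∕
NE9; spine 0/9 unchanged; 0/12 leaves instantiated on Bałaban's concrete objects (O1 = the substrate cell, owner R34).  HONEST DEPENDENCY
(cell line, verbatim): continuum YM on T⁴ ⇐ BetaPertH ∧ nine spine estimates (0/9 proved); BetaPertH ⇐ (D1) ∧ (D4) ∧ CAP+tail; G-an2-4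
gates asym, D1 and NE2/3/4.

WHY.  The W1 binder OF RECORD is stated in ENTRY currency — `WeightedEntrywiseRate Fk rawA rawB W c rate` («at step `k` every raw entry of
the two runs differs by at most `c·rate k·wt e`», `B13OpDatumJunctions`; produced on real backgrounds by the owner's `B13ReadingsRecord*` ∕
the substrate's W-21b face) — and the owner's Road-D socket modules deliver it OVER THE RECURSION CHART: g36-c §3
`weightedEntrywiseRate_complex_of_record` (real window + per-entry slice letters) and g38-a §4 `weightedEntrywiseRate_complex_of_drivingSlices`
(real window + (L1) species-in-chart holomorphy + a coordinate slice (L2′)(L3); road-agnostic by RULING R58: on the road of record the slices are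
FINE-FIELD slices and the real window is the AVERAGING-TOWER window `Set.range (sectionOfRecord D ι)`).  The Road-D ENDs, however, consume W1
in NORM currency at the chart points (`hop : ‖P.opA g k w − P.opB g k w‖ ≤ δ·θ^k·rOp k`); the adapter between the two — g36-c §4
`hop_of_weightedEntrywiseRate_floor` (`Op := OpDatum E`, margin floor `0 < r₀ ≤ rOp k`, `B13OpDatumJunctions.norm_opOf_sub_le`) — had no
consumer in the tree.  This part closes that junction ON THE COMPLEX CHANNEL ROAD (part 5's END `ne5_of_pointwiseSlots_reIm_insAtC`, p231181,
MI-3a discharged from row NE9's channel letters on the doubled chart): the per-point slots READ the ASSEMBLED operator data of raw entry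
families over the recursion chart (`P.opA g k w = opOf Fk rawA g (pr w) k`, ruling R49: operators row-blind, `pr := Prod.fst` on the doubled
chart `𝒰 × Fin 2`), and then the entry-currency W1 binder over the recursion chart IS the END's `hop`.  Composed with g36-c §3 ∕ g38-a §4
this gives the channel road's ENDs from the REAL-WINDOW W1 binder of rows NE2 (∧ NE3's displayed shape, per the record face used) plus
the slice ∕ chart letters — the sockets into which the instance row **E-avg** (owner R58: «the Road-D W1 chain at the instance on the
FINE-FIELD road, after W-22′»; first refusal to the leaf-06 ∕ leaf-02 lineages) plugs its output to conclude `T4OutputRate.NE5` BY NAME.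

WHAT ([folklore] composition BY NAME; NO estimate; 0 def).
* §1 `hop_of_weightedEntrywiseRate_opOf` — THE READING DICTIONARY: per-point slots on `Op := OpDatum E` over any chart `ι'` whose operator
  slots read `opOf Fk rawA g (pr w) k` ∕ `opOf Fk rawB g (pr w) k` through `pr : ι' → 𝒰`, with `RawBounded` ×2, `WeightedEntrywiseRate Fk
  rawA rawB W c rate` and a margin floor `0 < r₀ ≤ P.rOp k` ⟹ `‖P.opA g k w − P.opB g k w‖ ≤ (c∕r₀)·rate k·P.rOp k` (g36-c §4 BY NAME).
* §2 **`ne5_of_pointwiseSlots_reIm_insAtC_of_weightedEntrywiseRate`** — part 5's END with `hop` DISCHARGED by §1 at `rate k = θ^k`: every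
  other hypothesis VERBATIM IN TYPE (readings `hopA`∕`hopB`, `hRA`∕`hRB`, `hwer`, `hfl`∕`hr₀` in place of `hop`, `hδ`); conclusion LITERALLY
  `T4OutputRate.NE5 EA EB W κ θ (4G(c∕r₀ + δ′)(θ − ω)∕(θ − (1 + 4G(√2·c₉∕ω))ω))` over the ORIGINAL carriers (`c₉` = row NE9's profile
  constant, `c` here).
* §3 **`ne5_of_pointwiseSlots_reIm_insAtC_of_record_slices`** — §2 ∘ g36-c §3: W1 `hwer` on a REAL background type `BgR` at rate `θ^k`,
  readings `hAr`∕`hBr` (real data through `ρ : BgR → 𝒱`) and `hA`∕`hB` (chart points through `emb : 𝒰 → 𝒱`) into entry families `KA KB`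
  on the slice chart `𝒱`, and the PER-ENTRY seven-clause slice letters (relative depth `≤ r`, real feet in `Set.range ρ`, holomorphy on the
  open unit disc + continuity on the closed disc, one-run FORMAT bounds `B·wt e`) ⟹ `T4OutputRate.NE5` at the owner's degraded pair
  `θ₁ = θ^{1−λ(r)}`, `c₁ = δ^{1−λ}(2B)^{λ}`, `λ = (2∕π)arctan(2r∕(1−r²))`; W4 (`hinsRate`, stated at the ORIGINAL rate `θ`) degraded by
  the owner's `OutputRateComplexSliceEnd.insRate_mono_rate`.
* §4 **`ne5_of_pointwiseSlots_reIm_insAtC_of_chartSlices`** — §2 ∘ g38-a §4: the same with the per-entry slice letters PRODUCED from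
  (L1) species-in-chart holomorphy + format bound on the chart balls `‖c‖ < ϱ k b` (charts `χ : Ctr → Coord → 𝒱` centred at real data)
  and (L2′)(L3) a coordinate slice `a : ℂ → Coord` through every `(k, g, u, e)` — `DiffContOnCl ℂ a (ball 0 1)`, `MapsTo a (closedBall 0 1)
  (ball 0 (ϱ k b))`, feet `χ b (a z₀) = emb u`, `‖z₀‖ ≤ r`, real feet in `Set.range ρ` (the `hdrv` letter of g38-a, whose inhabitant of
  record is the substrate's W-22′ `SubstrateFineFieldChart` — complex block-averaging holomorphy + depth control, R58 (L2′)).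
NOT IN THIS FILE (said plainly).  No instance: which `E`, `Fk`, `rawA∕rawB`, `KA∕KB`, `BgR`, `ρ`, `emb`, `χ`, `ϱ`, `a` serve the record
is the substrate's (W-20 ∕ W-21b ∕ W-22′) and the owner's (`B13Readings*`) reading — row E-avg; `hwer` on `BgR` is rows NE2 (∧ NE3-shape)
's, asserted by nobody; no NE9 binder discharged; W2 (`henv`), W4 (`hinsRate`), the representation ∕ admissibility identities, the decay
bounds and the smallness stay DISPLAYED.  The twin compositions for the owner's per-point END `ne5_of_pointwiseSlots_reIm` (N204, `hdamp`
displayed) and for leaf-02's realified END (`InsertionChannelRealifyEnd`) are one line each and are left to those lineages.  Headline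
wording (owner R30 (ii) ∕ R35; referee INFO-38): «junction only ∕ END ⇐ instance letters»; never «leaf instantiated».  NE5 NOT PROVED;
NE9 NOT PROVED; spine 0/9; rung (B)+1 finite T⁴; NOT infinite volume ∕ mass gap ∕ Clay.  Axioms ⊆ {propext, Classical.choice, Quot.sound}.
-/

noncomputable section

open scoped BigOperators
open Finset Function Metric Set Complex Real

namespace Summit.QuantumFields.BalabanUV.T4Continuum.InsertionChannelFamily

open Literature.MathematicalPhysics.QuantumFieldTheory.Balaban1983to89
open Literature.MathematicalPhysics.QuantumFieldTheory.Balaban1983to89.T4OutputRate (Carriers Functional NE5)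
open Literature.MathematicalPhysics.QuantumFieldTheory.Balaban1983to89.T4InputCauchyRateData (StepModel tableA tableB)
open Literature.MathematicalPhysics.QuantumFieldTheory.Balaban1983to89.T4HistoryLipschitzRecursion
  (ChannelAdditive ChannelStepSum ChannelSizeAtStepNN)
open Summit.QuantumFields.BalabanUV.T4Continuum.B13HistDatum (HistFrame Hist)
open Summit.QuantumFields.BalabanUV.T4Continuum.B13OpDatum (Format OpDatum)
open Summit.QuantumFields.BalabanUV.T4Continuum.B13OpDatumJunctions (opOf RawBounded WeightedEntrywiseRate)
open Summit.QuantumFields.BalabanUV.T4Continuum.OutputRateFunctionalTablesPointwise (PointwiseSlots)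
open Summit.QuantumFields.BalabanUV.T4Continuum.OutputRateFunctionalTablesComplex (reImTab)
open Summit.QuantumFields.BalabanUV.T4Continuum.OutputRateComplexSliceEntrywise
  (hop_of_weightedEntrywiseRate_floor weightedEntrywiseRate_complex_of_record)
open Summit.QuantumFields.BalabanUV.T4Continuum.OutputRateComplexSliceEnd
  (insRate_mono_rate self_le_rpow_one_sub lossExp_nonneg degradedAmp_nonneg)
open Summit.QuantumFields.BalabanUV.T4Continuum.OutputRateDrivingSlices (weightedEntrywiseRate_complex_of_drivingSlices)

variable {C : Carriers} {𝒰 𝒱 ι : Type} {F : HistFrame C} {E : Type*}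

/-! ## §1 The reading dictionary: slots on `OpDatum E` reading the assembled data of raw entry families over the recursion chart -/

section Dictionary

variable {ι' : Type} {Hist' : Type*} [NormedAddCommGroup Hist'] [NormedSpace ℂ Hist'] (Q : PointwiseSlots C ι' (OpDatum E) Hist')

/-- [folklore] **THE READING DICTIONARY — ENTRY CURRENCY OVER THE RECURSION CHART ⟹ THE PER-POINT END's `hop`.**  Per-point slots `Q`
on `Op := OpDatum E` over a chart `ι'` whose operator slots READ, on the window `W`, the ASSEMBLED data of raw entry families
`rawA rawB : (ℕ → ℝ) → 𝒰 → ℕ → E → ℂ` over the recursion chart `𝒰` through `pr : ι' → 𝒰` (`Q.opA g k w = opOf Fk rawA g (pr w) k`;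
ruling R49: operators row-blind, `pr := Prod.fst` on the doubled chart); format-bounded suppliers (`RawBounded`), the W1 binder of record in
entry currency `WeightedEntrywiseRate Fk rawA rawB W c rate`, `0 ≤ c`, `0 ≤ rate k`, and an [I]-type margin floor `0 < r₀ ≤ Q.rOp k` ⟹
`‖Q.opA g k w − Q.opB g k w‖ ≤ (c∕r₀)·rate k·Q.rOp k` — g36-c §4 `hop_of_weightedEntrywiseRate_floor` BY NAME after the two rewrites. -/
theorem hop_of_weightedEntrywiseRate_opOf (Fk : ℕ → Format E) {rawA rawB : (ℕ → ℝ) → 𝒰 → ℕ → E → ℂ} {W : Set (ℕ → ℝ)}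
    {c r₀ : ℝ} {rate : ℕ → ℝ} (pr : ι' → 𝒰)
    (hopA : ∀ g ∈ W, ∀ (k : ℕ) (w : ι'), Q.opA g k w = opOf Fk rawA g (pr w) k)
    (hopB : ∀ g ∈ W, ∀ (k : ℕ) (w : ι'), Q.opB g k w = opOf Fk rawB g (pr w) k)
    (hRA : RawBounded Fk rawA W) (hRB : RawBounded Fk rawB W) (hwer : WeightedEntrywiseRate Fk rawA rawB W c rate)
    (hc : 0 ≤ c) (hrate : ∀ k, 0 ≤ rate k) (hfl : ∀ k, r₀ ≤ Q.rOp k) (hr₀ : 0 < r₀) :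
    ∀ k, ∀ g ∈ W, ∀ w : ι', ‖Q.opA g k w - Q.opB g k w‖ ≤ c / r₀ * rate k * Q.rOp k := by
  intro k g hg w
  rw [hopA g hg k w, hopB g hg k w]
  exact hop_of_weightedEntrywiseRate_floor Fk pr hRA hRB hwer hc hrate hfl hr₀ k g hg w

end Dictionary

/-! ## §2 END: part 5's channel-road END with `hop` DISCHARGED from the entry-currency W1 binder over the recursion chart -/

section End

variable {T : ℕ → (ℕ → ℝ) → (𝒰 × Fin 2 → C.Dom → ℝ) → ι → ℝ} {out : 𝒰 × Fin 2 → F.Idx → ι}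
variable (P : PointwiseSlots C (𝒰 × Fin 2) (OpDatum E) (Hist F))

/-- [folklore] `0 ≤ θ` is forced by the smallness letter of part 5's END (`(1 + 4G(√2·c∕ω))·ω < θ`, `0 ≤ G`, `0 ≤ c`, `0 < ω`). -/
theorem rate_nonneg_of_small {G c ω θ : ℝ} (hG : 0 ≤ G) (hc : 0 ≤ c) (hω : 0 < ω)
    (hsmall : (1 + 4 * G * (Real.sqrt 2 * c / ω)) * ω < θ) : 0 ≤ θ := by
  have h1 : 0 ≤ 4 * G * (Real.sqrt 2 * c / ω) := by positivity
  have h2 : (1 + 4 * G * (Real.sqrt 2 * c / ω)) * ω = ω + 4 * G * (Real.sqrt 2 * c / ω) * ω := by ring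
  nlinarith [mul_nonneg h1 hω.le]

/-- [folklore] **END — THE COMPLEX CHANNEL ROAD IN THE W1 ENTRY CURRENCY OF RECORD OVER THE RECURSION CHART.**  Part 5's
`ne5_of_pointwiseSlots_reIm_insAtC` (the owner's Re∕Im END on Road D's complex two-row chart, MI-3a discharged from row NE9's channel
letters on the doubled chart) for per-point slots on `Op := OpDatum E` whose operator slots READ the assembled data of raw entry families
`rawA rawB` over the recursion chart `𝒰` (§1's dictionary with `pr := Prod.fst`), with `hop` REPLACED by: `RawBounded` ×2 + the W1
binder of record in ENTRY currency `WeightedEntrywiseRate Fk rawA rawB W cW (k ↦ θ^k)` + a margin floor `0 < r₀ ≤ P.rOp k`.  Every other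
hypothesis VERBATIM IN TYPE; conclusion LITERALLY `T4OutputRate.NE5 EA EB W κ θ C₅` over the ORIGINAL carriers with part 5's constant at
`δ := cW∕r₀`. -/
theorem ne5_of_pointwiseSlots_reIm_insAtC_of_weightedEntrywiseRate [Nonempty 𝒰] (Fk : ℕ → Format E)
    {rawA rawB : (ℕ → ℝ) → 𝒰 → ℕ → E → ℂ} {ℰA ℰB : (ℕ → ℝ) → 𝒰 → C.Dom → ℂ} {EA : Functional C C.BgA}
    {EB : Functional C C.BgB} {W : Set (ℕ → ℝ)} {κ G E₀ cW r₀ δ' θ c ω : ℝ} {wt : ℕ → ι → ℝ} {τ : ℕ → ℕ → ℝ}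
    (hbdA : ∀ g ∈ W, ∀ k, BddAbove (Set.range fun w => ‖P.insA g k (tableA (reImTab (C := C) ℰA) g PUnit.unit) w‖))
    (hbdB : ∀ g ∈ W, ∀ k, BddAbove (Set.range fun w => ‖P.insB g k (tableB (reImTab (C := C) ℰB) g PUnit.unit) w‖))
    (hrA : ∀ g ∈ W, ∀ (X : C.Dom) (u : 𝒰) (i : Fin 2), ℰA g u X =
      P.Out (C.scale X) (P.opA g (C.scale X) (u, i))
        (P.insA g (C.scale X) (tableA (reImTab (C := C) ℰA) g PUnit.unit) (u, i)) X)
    (hrB : ∀ g ∈ W, ∀ (X : C.Dom) (u : 𝒰) (i : Fin 2), ℰB g u X =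
      P.Out (C.scale X) (P.opB g (C.scale X) (u, i))
        (P.insB g (C.scale X) (tableB (reImTab (C := C) ℰB) g PUnit.unit) (u, i)) X)
    (hbase : ∀ k, ∀ g ∈ W, ∀ w,
      (P.opB g k w, P.insB g k (tableB (reImTab (C := C) ℰB) g PUnit.unit) w) ∈ P.Base k g w)
    (henv : ∀ k, ∀ g ∈ W, ∀ w, ∀ q ∈ P.Base k g w, ∀ X : C.Dom, C.scale X = k →
      DifferentiableOn ℂ (fun z : OpDatum E × Hist F => P.Out k z.1 z.2 X) (closedBall q.1 (P.rOp k) ×ˢ closedBall q.2 (P.rHist k)) ∧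
        ∀ z ∈ closedBall q.1 (P.rOp k) ×ˢ closedBall q.2 (P.rHist k), ‖P.Out k z.1 z.2 X‖ ≤ G * Real.exp (-(κ * C.d X)))
    (hdA : ∀ g ∈ W, ∀ (u : 𝒰) (X : C.Dom), ‖ℰA g u X‖ ≤ G * Real.exp (-(κ * C.d X)))
    (hdB : ∀ g ∈ W, ∀ (u : 𝒰) (X : C.Dom), ‖ℰB g u X‖ ≤ E₀ * Real.exp (-(κ * C.d X))) (hE₀ : E₀ ≤ G)
    -- W1 in the ENTRY CURRENCY OF RECORD over the recursion chart, in place of part 5's `hop`: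
    (hopA : ∀ g ∈ W, ∀ (k : ℕ) (w : 𝒰 × Fin 2), P.opA g k w = opOf Fk rawA g w.1 k)
    (hopB : ∀ g ∈ W, ∀ (k : ℕ) (w : 𝒰 × Fin 2), P.opB g k w = opOf Fk rawB g w.1 k)
    (hRA : RawBounded Fk rawA W) (hRB : RawBounded Fk rawB W)
    (hwer : WeightedEntrywiseRate Fk rawA rawB W cW fun k => θ ^ k) (hcW : 0 ≤ cW)
    (hfl : ∀ k, r₀ ≤ P.rOp k) (hr₀ : 0 < r₀)
    -- W4, the channel reading, row NE9's letters and the arithmetic, as in part 5: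
    (hinsRate : ∀ k, ∀ g ∈ W, ∀ (t : C.Dom × (𝒰 × Fin 2) → ℝ), (∀ Y w, |t (Y, w)| ≤ E₀ * Real.exp (-(κ * C.d Y))) →
      ∀ w, ‖P.insA g k t w - P.insB g k t w‖ ≤ δ' * θ ^ k * P.rHist k)
    (hins : ∀ k, ∀ g ∈ W, ∀ (t : C.Dom × (𝒰 × Fin 2) → ℝ) (w : 𝒰 × Fin 2), P.insA g k t w = insAtOfChannelC T out g k t w)
    (hadd : ChannelAdditive (Set.univ : Set (𝒰 × Fin 2 → C.Dom → ℝ)) T)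
    (hsum : ChannelStepSum (Set.univ : Set (𝒰 × Fin 2 → C.Dom → ℝ)) T)
    (hsize : ChannelSizeAtStepNN (Set.univ : Set (𝒰 × Fin 2 → C.Dom → ℝ)) T κ wt τ) (hwt0 : ∀ k w i, 0 ≤ wt k (out w i))
    (hwt : ∀ k w i, wt k (out w i) ≤ P.rHist (k + 1) * F.wt i) (hτ : ∀ k j, j ≤ k → τ k j ≤ c * ω ^ (k - j))
    (hG : 0 ≤ G) (hδ' : 0 ≤ δ') (hc : 0 ≤ c) (hω : 0 < ω) (hsmall : (1 + 4 * G * (Real.sqrt 2 * c / ω)) * ω < θ)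
    (ι' : C.BgB → 𝒰) (hιA : ∀ g ∈ W, ∀ (U : C.BgB) (X : C.Dom), EA g (C.transport U) X = (ℰA g (ι' U) X).re)
    (hιB : ∀ g ∈ W, ∀ (U : C.BgB) (X : C.Dom), EB g U X = (ℰB g (ι' U) X).re) :
    NE5 EA EB W κ θ (4 * G * (cW / r₀ + δ') * (θ - ω) / (θ - (1 + 4 * G * (Real.sqrt 2 * c / ω)) * ω)) :=
  have hθ0 : 0 ≤ θ := rate_nonneg_of_small hG hc hω hsmall
  ne5_of_pointwiseSlots_reIm_insAtC P hbdA hbdB hrA hrB hbase henv hdA hdB hE₀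
    (hop_of_weightedEntrywiseRate_opOf P Fk Prod.fst hopA hopB hRA hRB hwer hcW (fun k => pow_nonneg hθ0 k) hfl hr₀)
    hinsRate hins hadd hsum hsize hwt0 hwt hτ hG (add_nonneg (div_nonneg hcW hr₀.le) hδ') hc hω hsmall ι' hιA hιB

/-! ## §3 END from the REAL WINDOW + the per-entry slice letters (g36-c §3 BY NAME) -/

/-- [folklore] **END — THE COMPLEX CHANNEL ROAD FROM THE REAL-WINDOW W1 BINDER OF RECORD AND THE PER-ENTRY SLICE LETTERS.**  §2 with its
entry-currency W1 binder over the recursion chart PRODUCED by the owner's g36-c §3 `weightedEntrywiseRate_complex_of_record`: raw suppliers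
`rawAr rawBr` on a REAL background type `BgR` carrying the W1 binder of record `hwer` at rate `θ^k` (rows NE2 (∧ NE3-shape)'s, on their
own datum type — the AVERAGING-TOWER window of ruling R58 (1′) at the instance), entry families `KA KB` on a slice chart `𝒱` read by the
real data through `ρ` (`hAr`∕`hBr`) and by the recursion chart through `emb` (`hA`∕`hB`), and through every `(k, g, u, e)` a slice of
relative depth `≤ r` with real feet in `Set.range ρ` along which that entry of each run is holomorphic on the open unit disc, continuous on
the closed disc and obeys the one-run FORMAT bound `B·wt e` (the slices of record are FINE-FIELD slices, R58).  W4 is displayed at the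
ORIGINAL rate `θ` and degraded by the owner's `insRate_mono_rate`.  Conclusion LITERALLY `T4OutputRate.NE5 EA EB W κ θ₁ C₅` at
`θ₁ = θ^{1−λ(r)}`, with §2's constant at `cW := δ^{1−λ}(2B)^{λ}`. -/
theorem ne5_of_pointwiseSlots_reIm_insAtC_of_record_slices [Nonempty 𝒰] (Fk : ℕ → Format E) {BgR : Type}
    {rawAr rawBr : (ℕ → ℝ) → BgR → ℕ → E → ℂ} {rawA rawB : (ℕ → ℝ) → 𝒰 → ℕ → E → ℂ}
    {KA KB : (ℕ → ℝ) → ℕ → 𝒱 → E → ℂ} (ρ : BgR → 𝒱) (emb : 𝒰 → 𝒱)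
    {ℰA ℰB : (ℕ → ℝ) → 𝒰 → C.Dom → ℂ} {EA : Functional C C.BgA}
    {EB : Functional C C.BgB} {W : Set (ℕ → ℝ)} {κ G E₀ δ B r r₀ δ' θ c ω : ℝ} {wt : ℕ → ι → ℝ} {τ : ℕ → ℕ → ℝ}
    (hbdA : ∀ g ∈ W, ∀ k, BddAbove (Set.range fun w => ‖P.insA g k (tableA (reImTab (C := C) ℰA) g PUnit.unit) w‖))
    (hbdB : ∀ g ∈ W, ∀ k, BddAbove (Set.range fun w => ‖P.insB g k (tableB (reImTab (C := C) ℰB) g PUnit.unit) w‖))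
    (hrA : ∀ g ∈ W, ∀ (X : C.Dom) (u : 𝒰) (i : Fin 2), ℰA g u X =
      P.Out (C.scale X) (P.opA g (C.scale X) (u, i))
        (P.insA g (C.scale X) (tableA (reImTab (C := C) ℰA) g PUnit.unit) (u, i)) X)
    (hrB : ∀ g ∈ W, ∀ (X : C.Dom) (u : 𝒰) (i : Fin 2), ℰB g u X =
      P.Out (C.scale X) (P.opB g (C.scale X) (u, i))
        (P.insB g (C.scale X) (tableB (reImTab (C := C) ℰB) g PUnit.unit) (u, i)) X)
    (hbase : ∀ k, ∀ g ∈ W, ∀ w,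
      (P.opB g k w, P.insB g k (tableB (reImTab (C := C) ℰB) g PUnit.unit) w) ∈ P.Base k g w)
    (henv : ∀ k, ∀ g ∈ W, ∀ w, ∀ q ∈ P.Base k g w, ∀ X : C.Dom, C.scale X = k →
      DifferentiableOn ℂ (fun z : OpDatum E × Hist F => P.Out k z.1 z.2 X) (closedBall q.1 (P.rOp k) ×ˢ closedBall q.2 (P.rHist k)) ∧
        ∀ z ∈ closedBall q.1 (P.rOp k) ×ˢ closedBall q.2 (P.rHist k), ‖P.Out k z.1 z.2 X‖ ≤ G * Real.exp (-(κ * C.d X)))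
    (hdA : ∀ g ∈ W, ∀ (u : 𝒰) (X : C.Dom), ‖ℰA g u X‖ ≤ G * Real.exp (-(κ * C.d X)))
    (hdB : ∀ g ∈ W, ∀ (u : 𝒰) (X : C.Dom), ‖ℰB g u X‖ ≤ E₀ * Real.exp (-(κ * C.d X))) (hE₀ : E₀ ≤ G)
    -- the reading dictionary of §1∕§2 and the readings of g36-c §3:
    (hopA : ∀ g ∈ W, ∀ (k : ℕ) (w : 𝒰 × Fin 2), P.opA g k w = opOf Fk rawA g w.1 k)
    (hopB : ∀ g ∈ W, ∀ (k : ℕ) (w : 𝒰 × Fin 2), P.opB g k w = opOf Fk rawB g w.1 k)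
    (hAr : ∀ g ∈ W, ∀ b k, rawAr g b k = KA g k (ρ b)) (hBr : ∀ g ∈ W, ∀ b k, rawBr g b k = KB g k (ρ b))
    (hA : ∀ g ∈ W, ∀ u k, rawA g u k = KA g k (emb u)) (hB : ∀ g ∈ W, ∀ u k, rawB g u k = KB g k (emb u))
    -- W1 OF RECORD on the real background type, and the per-entry slice letters:
    (hwer : WeightedEntrywiseRate Fk rawAr rawBr W δ fun k => θ ^ k)
    (hslice : ∀ k, ∀ g ∈ W, ∀ (u : 𝒰) (e : E), ∃ γ : ℂ → 𝒱, ∃ z₀ : ℂ, ‖z₀‖ ≤ r ∧ γ z₀ = emb u ∧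
      (∀ x : ℝ, |x| < 1 → γ x ∈ Set.range ρ) ∧
      DiffContOnCl ℂ (fun z => KA g k (γ z) e) (ball 0 1) ∧ DiffContOnCl ℂ (fun z => KB g k (γ z) e) (ball 0 1) ∧
        (∀ z : ℂ, ‖z‖ ≤ 1 → ‖KA g k (γ z) e‖ ≤ B * (Fk k).wt e) ∧ ∀ z : ℂ, ‖z‖ ≤ 1 → ‖KB g k (γ z) e‖ ≤ B * (Fk k).wt e)
    (hδ0 : 0 ≤ δ) (hδB : δ ≤ 2 * B) (hθ0 : 0 ≤ θ) (hθ1 : θ ≤ 1) (hr0 : 0 ≤ r) (hr : r < 1)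
    (hfl : ∀ k, r₀ ≤ P.rOp k) (hr₀ : 0 < r₀)
    -- W4 (at the ORIGINAL rate `θ`), the channel reading, row NE9's letters and the arithmetic, as in part 5:
    (hinsRate : ∀ k, ∀ g ∈ W, ∀ (t : C.Dom × (𝒰 × Fin 2) → ℝ), (∀ Y w, |t (Y, w)| ≤ E₀ * Real.exp (-(κ * C.d Y))) →
      ∀ w, ‖P.insA g k t w - P.insB g k t w‖ ≤ δ' * θ ^ k * P.rHist k)
    (hins : ∀ k, ∀ g ∈ W, ∀ (t : C.Dom × (𝒰 × Fin 2) → ℝ) (w : 𝒰 × Fin 2), P.insA g k t w = insAtOfChannelC T out g k t w)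
    (hadd : ChannelAdditive (Set.univ : Set (𝒰 × Fin 2 → C.Dom → ℝ)) T)
    (hsum : ChannelStepSum (Set.univ : Set (𝒰 × Fin 2 → C.Dom → ℝ)) T)
    (hsize : ChannelSizeAtStepNN (Set.univ : Set (𝒰 × Fin 2 → C.Dom → ℝ)) T κ wt τ) (hwt0 : ∀ k w i, 0 ≤ wt k (out w i))
    (hwt : ∀ k w i, wt k (out w i) ≤ P.rHist (k + 1) * F.wt i) (hτ : ∀ k j, j ≤ k → τ k j ≤ c * ω ^ (k - j))
    (hG : 0 ≤ G) (hδ' : 0 ≤ δ') (hc : 0 ≤ c) (hω : 0 < ω)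
    (hsmall : (1 + 4 * G * (Real.sqrt 2 * c / ω)) * ω < θ ^ (1 - (2 / π * Real.arctan (2 * r / (1 - r ^ 2)))))
    (ι' : C.BgB → 𝒰) (hιA : ∀ g ∈ W, ∀ (U : C.BgB) (X : C.Dom), EA g (C.transport U) X = (ℰA g (ι' U) X).re)
    (hιB : ∀ g ∈ W, ∀ (U : C.BgB) (X : C.Dom), EB g U X = (ℰB g (ι' U) X).re) :
    NE5 EA EB W κ (θ ^ (1 - (2 / π * Real.arctan (2 * r / (1 - r ^ 2)))))
      (4 * G * (δ ^ (1 - 2 / π * Real.arctan (2 * r / (1 - r ^ 2))) * (2 * B) ^ (2 / π * Real.arctan (2 * r / (1 - r ^ 2))) / r₀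
            + δ') *
          (θ ^ (1 - (2 / π * Real.arctan (2 * r / (1 - r ^ 2)))) - ω) /
        (θ ^ (1 - (2 / π * Real.arctan (2 * r / (1 - r ^ 2)))) - (1 + 4 * G * (Real.sqrt 2 * c / ω)) * ω)) := by
  obtain ⟨hW, hRA, hRB⟩ := weightedEntrywiseRate_complex_of_record Fk ρ emb hδ0 hδB hθ0 hθ1 hr hAr hBr hA hB hwer hslice
  exact ne5_of_pointwiseSlots_reIm_insAtC_of_weightedEntrywiseRate P Fk hbdA hbdB hrA hrB hbase henv hdA hdB hE₀ hopA hopB hRA hRB hW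
    (degradedAmp_nonneg hδ0 hδB) hfl hr₀
    (insRate_mono_rate P hδ' hθ0 (self_le_rpow_one_sub hθ0 hθ1 (lossExp_nonneg hr0 hr)) hinsRate)
    hins hadd hsum hsize hwt0 hwt hτ hG hδ' hc hω hsmall ι' hιA hιB

/-! ## §4 END from the real window + (L1) species-in-chart letters + coordinate slices (g38-a §4 BY NAME): the socket of row E-avg -/

variable {Coord : Type*} [NormedAddCommGroup Coord] [NormedSpace ℂ Coord] {Ctr : Type}

/-- [folklore] **END — THE COMPLEX CHANNEL ROAD FROM THE REAL-WINDOW W1 BINDER, SPECIES-IN-CHART HOLOMORPHY AND COORDINATE SLICES**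
(the channel-road socket of the instance row E-avg).  §2 with its entry-currency W1 binder over the recursion chart PRODUCED by the
owner's g38-a §4 `weightedEntrywiseRate_complex_of_drivingSlices` (road-agnostic, R58): the real-window W1 binder `hwer` on `BgR` and the
readings as in §3; (L1) for every level, window coupling, centre `b : Ctr` and entry, each run's entry family composed with the chart
`χ b : Coord → 𝒱` is ℂ-differentiable on the coordinate ball `‖c‖ < ϱ k b` and obeys the one-run format bound `B·wt e` there
(substrate: landed for the covariance ∕ Green species on the explicit ball); (L2′)+(L3) through every `(k, g, u, e)` a centre `b`, a
COORDINATE SLICE `a : ℂ → Coord` and `z₀` with `‖z₀‖ ≤ r`, `χ b (a z₀) = emb u`, real feet `χ b (a x) ∈ Set.range ρ` (`|x| < 1`),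
`DiffContOnCl ℂ a (ball 0 1)`, `MapsTo a (closedBall 0 1) (ball 0 (ϱ k b))` — on the road of record the complex block-averaging
holomorphy + depth-control letter of the substrate's W-22′ `SubstrateFineFieldChart` (asserted by nobody here).  Conclusion LITERALLY
`T4OutputRate.NE5 EA EB W κ θ₁ C₅`, the same degraded pair and constant as §3. -/
theorem ne5_of_pointwiseSlots_reIm_insAtC_of_chartSlices [Nonempty 𝒰] (Fk : ℕ → Format E) {BgR : Type}
    {rawAr rawBr : (ℕ → ℝ) → BgR → ℕ → E → ℂ} {rawA rawB : (ℕ → ℝ) → 𝒰 → ℕ → E → ℂ}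
    {KA KB : (ℕ → ℝ) → ℕ → 𝒱 → E → ℂ} (ρ : BgR → 𝒱) (emb : 𝒰 → 𝒱) (χ : Ctr → Coord → 𝒱) {ϱ : ℕ → Ctr → ℝ}
    {ℰA ℰB : (ℕ → ℝ) → 𝒰 → C.Dom → ℂ} {EA : Functional C C.BgA}
    {EB : Functional C C.BgB} {W : Set (ℕ → ℝ)} {κ G E₀ δ B r r₀ δ' θ c ω : ℝ} {wt : ℕ → ι → ℝ} {τ : ℕ → ℕ → ℝ}
    (hbdA : ∀ g ∈ W, ∀ k, BddAbove (Set.range fun w => ‖P.insA g k (tableA (reImTab (C := C) ℰA) g PUnit.unit) w‖))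
    (hbdB : ∀ g ∈ W, ∀ k, BddAbove (Set.range fun w => ‖P.insB g k (tableB (reImTab (C := C) ℰB) g PUnit.unit) w‖))
    (hrA : ∀ g ∈ W, ∀ (X : C.Dom) (u : 𝒰) (i : Fin 2), ℰA g u X =
      P.Out (C.scale X) (P.opA g (C.scale X) (u, i))
        (P.insA g (C.scale X) (tableA (reImTab (C := C) ℰA) g PUnit.unit) (u, i)) X)
    (hrB : ∀ g ∈ W, ∀ (X : C.Dom) (u : 𝒰) (i : Fin 2), ℰB g u X =
      P.Out (C.scale X) (P.opB g (C.scale X) (u, i))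
        (P.insB g (C.scale X) (tableB (reImTab (C := C) ℰB) g PUnit.unit) (u, i)) X)
    (hbase : ∀ k, ∀ g ∈ W, ∀ w,
      (P.opB g k w, P.insB g k (tableB (reImTab (C := C) ℰB) g PUnit.unit) w) ∈ P.Base k g w)
    (henv : ∀ k, ∀ g ∈ W, ∀ w, ∀ q ∈ P.Base k g w, ∀ X : C.Dom, C.scale X = k →
      DifferentiableOn ℂ (fun z : OpDatum E × Hist F => P.Out k z.1 z.2 X) (closedBall q.1 (P.rOp k) ×ˢ closedBall q.2 (P.rHist k)) ∧
        ∀ z ∈ closedBall q.1 (P.rOp k) ×ˢ closedBall q.2 (P.rHist k), ‖P.Out k z.1 z.2 X‖ ≤ G * Real.exp (-(κ * C.d X)))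
    (hdA : ∀ g ∈ W, ∀ (u : 𝒰) (X : C.Dom), ‖ℰA g u X‖ ≤ G * Real.exp (-(κ * C.d X)))
    (hdB : ∀ g ∈ W, ∀ (u : 𝒰) (X : C.Dom), ‖ℰB g u X‖ ≤ E₀ * Real.exp (-(κ * C.d X))) (hE₀ : E₀ ≤ G)
    -- the reading dictionary of §1∕§2 and the readings of g38-a §4:
    (hopA : ∀ g ∈ W, ∀ (k : ℕ) (w : 𝒰 × Fin 2), P.opA g k w = opOf Fk rawA g w.1 k)
    (hopB : ∀ g ∈ W, ∀ (k : ℕ) (w : 𝒰 × Fin 2), P.opB g k w = opOf Fk rawB g w.1 k)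
    (hAr : ∀ g ∈ W, ∀ b k, rawAr g b k = KA g k (ρ b)) (hBr : ∀ g ∈ W, ∀ b k, rawBr g b k = KB g k (ρ b))
    (hA : ∀ g ∈ W, ∀ u k, rawA g u k = KA g k (emb u)) (hB : ∀ g ∈ W, ∀ u k, rawB g u k = KB g k (emb u))
    -- W1 OF RECORD on the real background type, (L1) species-in-chart letters, (L2′)(L3) coordinate slices:
    (hwer : WeightedEntrywiseRate Fk rawAr rawBr W δ fun k => θ ^ k)
    (hKA : ∀ k, ∀ g ∈ W, ∀ (b : Ctr) (e : E), DifferentiableOn ℂ (fun c => KA g k (χ b c) e) (ball 0 (ϱ k b)) ∧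
      ∀ c ∈ ball (0 : Coord) (ϱ k b), ‖KA g k (χ b c) e‖ ≤ B * (Fk k).wt e)
    (hKB : ∀ k, ∀ g ∈ W, ∀ (b : Ctr) (e : E), DifferentiableOn ℂ (fun c => KB g k (χ b c) e) (ball 0 (ϱ k b)) ∧
      ∀ c ∈ ball (0 : Coord) (ϱ k b), ‖KB g k (χ b c) e‖ ≤ B * (Fk k).wt e)
    (hdrv : ∀ k, ∀ g ∈ W, ∀ (u : 𝒰) (e : E), ∃ (b : Ctr) (a : ℂ → Coord) (z₀ : ℂ), ‖z₀‖ ≤ r ∧ χ b (a z₀) = emb u ∧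
      (∀ x : ℝ, |x| < 1 → χ b (a x) ∈ Set.range ρ) ∧ DiffContOnCl ℂ a (ball 0 1) ∧ MapsTo a (closedBall 0 1) (ball 0 (ϱ k b)))
    (hδ0 : 0 ≤ δ) (hδB : δ ≤ 2 * B) (hθ0 : 0 ≤ θ) (hθ1 : θ ≤ 1) (hr0 : 0 ≤ r) (hr : r < 1)
    (hfl : ∀ k, r₀ ≤ P.rOp k) (hr₀ : 0 < r₀)
    -- W4 (at the ORIGINAL rate `θ`), the channel reading, row NE9's letters and the arithmetic, as in part 5:
    (hinsRate : ∀ k, ∀ g ∈ W, ∀ (t : C.Dom × (𝒰 × Fin 2) → ℝ), (∀ Y w, |t (Y, w)| ≤ E₀ * Real.exp (-(κ * C.d Y))) →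
      ∀ w, ‖P.insA g k t w - P.insB g k t w‖ ≤ δ' * θ ^ k * P.rHist k)
    (hins : ∀ k, ∀ g ∈ W, ∀ (t : C.Dom × (𝒰 × Fin 2) → ℝ) (w : 𝒰 × Fin 2), P.insA g k t w = insAtOfChannelC T out g k t w)
    (hadd : ChannelAdditive (Set.univ : Set (𝒰 × Fin 2 → C.Dom → ℝ)) T)
    (hsum : ChannelStepSum (Set.univ : Set (𝒰 × Fin 2 → C.Dom → ℝ)) T)
    (hsize : ChannelSizeAtStepNN (Set.univ : Set (𝒰 × Fin 2 → C.Dom → ℝ)) T κ wt τ) (hwt0 : ∀ k w i, 0 ≤ wt k (out w i))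
    (hwt : ∀ k w i, wt k (out w i) ≤ P.rHist (k + 1) * F.wt i) (hτ : ∀ k j, j ≤ k → τ k j ≤ c * ω ^ (k - j))
    (hG : 0 ≤ G) (hδ' : 0 ≤ δ') (hc : 0 ≤ c) (hω : 0 < ω)
    (hsmall : (1 + 4 * G * (Real.sqrt 2 * c / ω)) * ω < θ ^ (1 - (2 / π * Real.arctan (2 * r / (1 - r ^ 2)))))
    (ι' : C.BgB → 𝒰) (hιA : ∀ g ∈ W, ∀ (U : C.BgB) (X : C.Dom), EA g (C.transport U) X = (ℰA g (ι' U) X).re)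
    (hιB : ∀ g ∈ W, ∀ (U : C.BgB) (X : C.Dom), EB g U X = (ℰB g (ι' U) X).re) :
    NE5 EA EB W κ (θ ^ (1 - (2 / π * Real.arctan (2 * r / (1 - r ^ 2)))))
      (4 * G * (δ ^ (1 - 2 / π * Real.arctan (2 * r / (1 - r ^ 2))) * (2 * B) ^ (2 / π * Real.arctan (2 * r / (1 - r ^ 2))) / r₀
            + δ') *
          (θ ^ (1 - (2 / π * Real.arctan (2 * r / (1 - r ^ 2)))) - ω) /
        (θ ^ (1 - (2 / π * Real.arctan (2 * r / (1 - r ^ 2)))) - (1 + 4 * G * (Real.sqrt 2 * c / ω)) * ω)) := by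
  obtain ⟨hW, hRA, hRB⟩ :=
    weightedEntrywiseRate_complex_of_drivingSlices Fk ρ emb χ hδ0 hδB hθ0 hθ1 hr hAr hBr hA hB hwer hKA hKB hdrv
  exact ne5_of_pointwiseSlots_reIm_insAtC_of_weightedEntrywiseRate P Fk hbdA hbdB hrA hrB hbase henv hdA hdB hE₀ hopA hopB hRA hRB hW
    (degradedAmp_nonneg hδ0 hδB) hfl hr₀
    (insRate_mono_rate P hδ' hθ0 (self_le_rpow_one_sub hθ0 hθ1 (lossExp_nonneg hr0 hr)) hinsRate)
    hins hadd hsum hsize hwt0 hwt hτ hG hδ' hc hω hsmall ι' hιA hιB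

end End

end Summit.QuantumFields.BalabanUV.T4Continuum.InsertionChannelFamily

end
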